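import Literature.Analysis.FluidPDE.NSBoundedMildOseenIntegral
import Literature.Analysis.FluidPDE.NSBoundedMildSmoothing
import HarnessLib

/-!
# The Duhamel term of two bounded fields from a general base time vanishes at infinity under
# the heat flow

Analysis/FluidPDE proofs-layer file (theorems only). The tree's
`exists_norm_heatExtension_oseenDuhamel_le` (`NSBoundedMildOseenIntegral.lean`; Lemarié-Rieusset
2016, Def. 6.5 and Lemma 6.4 (B): `lim_{τ→∞} e^{τΔ}Q = 0` for the Oseen right-hand side) treats
the diagonal Duhamel term `B^ν_0(u, u)(t)` of a globally strongly measurable bounded field. The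
Oseen representation of localised classical solutions (proof of the named fact
`Literature.Analysis.FluidPDE.bradshawGrujicKukavica2015_local_analyticity_radius`) needs the same
for `B¹_{s₀}(u, v)(t)` with **two different** fields, a **general base time** `s₀`, and fields that
are only known to be measurable and bounded on the slab `(s₀, t) × E`:

* `exists_norm_heatExtension_oseenDuhamel_le_of_bound` — for `u, v` a.e. strongly measurable on
  `(s₀, t) × E` and bounded by `M` there, `s₀ < t`, there is `C` with
  `‖e^{τΔ} B¹_{s₀}(u, v)(t) (x)‖ ≤ C τ^{-1/2}` for all `τ > 0`, `x`.

Proof: translate the base time to `0` (`oseenDuhamel_translate`), truncate the translated fields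
to the time interval `(0, t - s₀)` (this does not change the Duhamel term,
`oseenDuhamel_congr_ae_slice`), so that they lie in Koch–Tataru's path space
(`eKochTataruNorm_lt_top_of_bound_of_eq_zero`; the time shear is measure preserving,
`measurePreserving_timeShift` of `LerayHopfRestart.lean`), identify `B¹_0 = kochTataruBilinear`
(`kochTataruBilinear_eq_oseenDuhamel`) and apply the decay estimate
`exists_norm_heatExtension_kochTataruBilinear_le` (`KochTataruIntegralOfClass.lean`).

## References

* P. G. Lemarié-Rieusset, *The Navier–Stokes Problem in the 21st Century*, CRC Press 2016,
  Def. 6.5 and Lemma 6.4 (B). [LemarieRieusset2016]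
* H. Koch, D. Tataru, Adv. Math. 157 (2001), §1 (3), §3. [KochTataruAdvMath2001]
-/

noncomputable section

open MeasureTheory Set Function Filter Metric Real
open _root_.Topology
open scoped ENNReal

namespace Literature.Analysis.FluidPDE

variable {E : Type*} [NormedAddCommGroup E] [InnerProductSpace ℝ E] [FiniteDimensional ℝ E]
  [MeasurableSpace E] [BorelSpace E]

/-- **A slab-measurable field, translated in time and truncated to `(0, T)`, is measurable on
`(0, ∞) × E`.** [folklore] -/
theorem aestronglyMeasurable_uncurry_indicator_shift {u : ℝ → E → E} {s₀ t : ℝ}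
    (hu : AEStronglyMeasurable (uncurry u)
      ((volume : Measure (ℝ × E)).restrict (Ioo s₀ t ×ˢ univ))) :
    AEStronglyMeasurable (uncurry ((Ioo 0 (t - s₀)).indicator fun σ => u (σ + s₀)))
      ((volume : Measure (ℝ × E)).restrict (Ioi 0 ×ˢ univ)) := by
  -- the uncurried truncated field is the indicator of the slab `(0, t - s₀) × E`
  have hunc : uncurry ((Ioo 0 (t - s₀)).indicator fun σ => u (σ + s₀)) =
      (Ioo 0 (t - s₀) ×ˢ (univ : Set E)).indicator (fun z : ℝ × E => u (z.1 + s₀) z.2) := by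
    funext z
    by_cases hz : z.1 ∈ Ioo 0 (t - s₀)
    · rw [uncurry, Set.indicator_of_mem hz, Set.indicator_of_mem (mk_mem_prod hz (mem_univ _))]
    · rw [uncurry, Set.indicator_of_notMem hz, Set.indicator_of_notMem (fun h => hz h.1)]
      rfl
  rw [hunc, aestronglyMeasurable_indicator_iff (measurableSet_Ioo.prod MeasurableSet.univ),
    Measure.restrict_restrict (measurableSet_Ioo.prod MeasurableSet.univ)]
  have hset : Ioo 0 (t - s₀) ×ˢ (univ : Set E) ∩ Ioi 0 ×ˢ univ = Ioo 0 (t - s₀) ×ˢ univ := by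
    rw [prod_inter_prod, univ_inter]
    congr 1
    exact inter_eq_left.2 fun σ hσ => hσ.1
  rw [hset]
  -- pull back `hu` along the measure-preserving shear, restricted to the preimage
  have hmp := measurePreserving_timeShift (E := E) s₀
  have hpre : (fun z : ℝ × E => ((z.1 + s₀, z.2) : ℝ × E)) ⁻¹' (Ioo s₀ t ×ˢ univ) =
      Ioo 0 (t - s₀) ×ˢ univ := by
    ext z
    simp only [mem_preimage, mem_prod, mem_univ, and_true, mem_Ioo]
    constructor <;> intro h <;> constructor <;> linarith [h.1, h.2]
  have hres := hmp.restrict_preimage (s := Ioo s₀ t ×ˢ (univ : Set E))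
    (measurableSet_Ioo.prod MeasurableSet.univ)
  rw [hpre] at hres
  exact hu.comp_measurePreserving hres

/-- **The Duhamel term of two bounded fields from a general base time vanishes at infinity
under the heat flow**: `‖e^{τΔ}B¹_{s₀}(u,v)(t)(x)‖ ≤ C τ^{-1/2}` for all `τ > 0`, `x`.
[cite: LemarieRieusset2016, Def. 6.5 and Lemma 6.4 (B)] -/
theorem exists_norm_heatExtension_oseenDuhamel_le_of_bound {u v : ℝ → E → E} {s₀ t M : ℝ}
    (hu : AEStronglyMeasurable (uncurry u) ((volume : Measure (ℝ × E)).restrict (Ioo s₀ t ×ˢ univ)))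
    (hv : AEStronglyMeasurable (uncurry v) ((volume : Measure (ℝ × E)).restrict (Ioo s₀ t ×ˢ univ)))
    (hM : 0 ≤ M) (huM : ∀ τ ∈ Ioo s₀ t, ∀ y, ‖u τ y‖ ≤ M) (hvM : ∀ τ ∈ Ioo s₀ t, ∀ y, ‖v τ y‖ ≤ M)
    (hst : s₀ < t) :
    ∃ C : ℝ, ∀ ⦃τ : ℝ⦄, 0 < τ → ∀ x : E,
      ‖UnboundedOperators.heatExtension (oseenDuhamel 1 s₀ u v t) τ x‖ ≤ C * τ ^ (-(1 / 2 : ℝ)) := by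
  set T : ℝ := t - s₀ with hT
  have hT0 : 0 < T := sub_pos.2 hst
  set U : ℝ → E → E := (Ioo 0 T).indicator fun σ => u (σ + s₀) with hU
  set V : ℝ → E → E := (Ioo 0 T).indicator fun σ => v (σ + s₀) with hV
  -- bounds and vanishing of the truncated fields
  have hUb : ∀ σ y, ‖U σ y‖ ≤ M := by
    intro σ y
    by_cases hσ : σ ∈ Ioo 0 T
    · rw [hU, Set.indicator_of_mem hσ]
      exact huM _ ⟨by linarith [hσ.1], by linarith [hσ.2]⟩ y
    · rw [hU, Set.indicator_of_notMem hσ]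
      simpa using hM
  have hVb : ∀ σ y, ‖V σ y‖ ≤ M := by
    intro σ y
    by_cases hσ : σ ∈ Ioo 0 T
    · rw [hV, Set.indicator_of_mem hσ]
      exact hvM _ ⟨by linarith [hσ.1], by linarith [hσ.2]⟩ y
    · rw [hV, Set.indicator_of_notMem hσ]
      simpa using hM
  have hUz : ∀ σ, T ≤ σ → U σ = 0 := fun σ hσ => by
    rw [hU, Set.indicator_of_notMem (fun h => (not_lt.2 hσ) h.2)]
  have hVz : ∀ σ, T ≤ σ → V σ = 0 := fun σ hσ => by
    rw [hV, Set.indicator_of_notMem (fun h => (not_lt.2 hσ) h.2)]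
  have hUX := eKochTataruNorm_lt_top_of_bound_of_eq_zero hM hUb hUz
  have hVX := eKochTataruNorm_lt_top_of_bound_of_eq_zero hM hVb hVz
  have hUm := aestronglyMeasurable_uncurry_indicator_shift hu
  have hVm := aestronglyMeasurable_uncurry_indicator_shift hv
  -- `B¹_{s₀}(u,v)(t) = B¹_0(u(·+s₀), v(·+s₀))(t - s₀) = kochTataruBilinear U V (t - s₀)`
  have hB : oseenDuhamel 1 s₀ u v t = kochTataruBilinear U V T := by
    funext x
    have h1 := oseenDuhamel_translate 1 0 s₀ u v T x
    rw [zero_add, hT, sub_add_cancel] at h1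
    rw [← h1, kochTataruBilinear_eq_oseenDuhamel]
    refine oseenDuhamel_congr_ae_slice (fun σ hσ => Eventually.of_forall fun y => ?_)
      (fun σ hσ => Eventually.of_forall fun y => ?_) x
    · show u (σ + s₀) y = U σ y
      rw [hU, Set.indicator_of_mem hσ]
    · show v (σ + s₀) y = V σ y
      rw [hV, Set.indicator_of_mem hσ]
  obtain ⟨C, -, hC⟩ := exists_norm_heatExtension_kochTataruBilinear_le (E := E)
  refine ⟨C * (eKochTataruNorm U).toReal * (eKochTataruNorm V).toReal, fun τ hτ x => ?_⟩
  rw [hB]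
  calc ‖UnboundedOperators.heatExtension (kochTataruBilinear U V T) τ x‖
      ≤ C * τ ^ (-(1 / 2 : ℝ)) * (eKochTataruNorm U).toReal * (eKochTataruNorm V).toReal :=
        hC hUm hVm hUX hVX hT0 hτ x
    _ = C * (eKochTataruNorm U).toReal * (eKochTataruNorm V).toReal * τ ^ (-(1 / 2 : ℝ)) := by ring

end Literature.Analysis.FluidPDE
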